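import Literature.IUT.LogVolume.DHFieldOfModuliBabySzpiro
import Literature.IUT.LogVolume.DHProbabilisticSzpiroCorrected
import Literature.IUT.LogVolume.InitialThetaDataBadPlaceRamification
import HarnessLib

/-!
# Dupuy–Hilado (arXiv:2004.13108v2) at an initial Θ-datum: "bad ⇒ ramified" (p.22 l.24, "by
# Néron–Ogg–Shafarevich") DISCHARGED from [IUTchI] Def. 3.1 (c), and Thms 1.0.3 (corrected) / 1.0.4 at `D`

PROOF-ONLY sequel (T. Dupuy, A. Hilado, arXiv:2004.13108v2 [DupuyHilado2020], UNREFEREED; held render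
`book:anonnd-2004-13108v2`, locators `p.N l.M`). No new definition, no new `Prop` fact. Cited BY NAME:
`sectionRamificationOf`, `BabySzpiroThm`, `babySzpiroThm_of_inputs` (`DHFieldOfModuli*`),
`probabilisticSzpiro_corrected` (`DHProbabilisticSzpiroCorrected`), `ThetaData.pilotData_S`,
`ThetaData.mk_mem_VFbad_of_under`, `ThetaData.under_liftPlace` (`InitialThetaDataVolume`), and abc-iut-w5-d009's
`ThetaData.absRamificationIdx_ne_one_of_under_mem_VFbad` (`InitialThetaDataBadPlaceRamification`: every bad
place of `K` has `e(w|p)` divisible by `l`, from Def. 3.1 (c) "`l` prime to the orders of the `q`-parameters" and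
Ex. 3.2 (iv) "`q_v` admits a `2l`-th root in `K_v̲`").

## What is PROVED

* `sectionRamificationOf_e_ne_one` — **the hypothesis "bad ⇒ ramified" of the corrected chain HOLDS at every
  initial Θ-datum**: for `v ∈ V^bad_mod` (= `(pilotData D).S`), `e(v̲/p) ≠ 1` for `v̲ = liftPlace D v`. Print
  (Lemma 6.3.1 proof, p.22 l.24) invokes Néron–Ogg–Shafarevich ("in the case that `v⃗` is unramified we know
  that `a_{j,v_j} = 1`"); the tree's route is [IUTchI] Def. 3.1 (c) + Ex. 3.2 (iv) (`l ∣ e(v̲|v_F)`, hence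
  `e(v̲|p) ≥ l ≥ 5`), which needs no NOS.
* `probabilisticSzpiro_corrected_thetaData` — Thm 1.0.3 = 7.12.1 at `D` with the constants the printed chain
  supports ((7.15) corrected, `DHProbabilisticSzpiroCorrected`), now from (7.4) ALONE: for `T` a set of primes
  containing the residue characteristics of `V^bad_mod`, `Ineq74 ⟹ (1/(6+ε_l))·deĝ̲(𝔮) ≤ ln Diff + Σ_p ln e_p
  + [ln π + (4/(l+5))·Σ_p (1 − P_{unr,p}^{(l+1)/2}) ln p]`.
* `babySzpiroThm_of_ineq718` — Thm 1.0.4 = 7.13.1 at `D` (the typed `BabySzpiroThm D T`, conclusion (7.17) AS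
  PRINTED) from (7.18) at `D` and print's floor `[K:ℚ], |Disc(K/ℚ)| ≥ 6840` only.

HONEST FRAMING: (7.4) = `Ineq74` — the authors' reading of the DISPUTED [IUTchIII] Cor. 3.12
[claim: Mochizuki2012, status: disputed] + Claim 5.0.1 [claim: DupuyHilado2020, status: under-review] —
remains a hypothesis (explicit, or internal to the template) and is never asserted; (7.18) likewise. Typed ≠
proved ≠ endorsed; no side is taken on any author; no abc claim.
-/

noncomputable section

namespace Literature.IUT.LogVolume

namespace ExplicitSzpiro

open Literature.IUT.HodgeTheaters NumberField IsDedekindDomain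

variable {F K Fbar : Type} [Field F] [NumberField F] [Field K] [NumberField K] [Algebra F K]
  [Field Fbar] [Algebra F Fbar] [Algebra K Fbar] [DecidableEq F] [DecidableEq Fbar]
  {E : WeierstrassCurve F} [E.IsElliptic] {l : ℕ}
  {Pb : BadPlacePredicates K} (D : InitialThetaData F K Fbar E l Pb)

omit [DecidableEq F] [DecidableEq Fbar] in
/-- **"Bad ⇒ ramified" at an initial Θ-datum, PROVED**: for `v ∈ V^bad_mod` the lift `v̲ = liftPlace D v`
has `e(v̲/p) ≠ 1` — the hypothesis `hNOS` of `E2_radiusLn_le` / `probabilisticSzpiro_corrected` /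
`babySzpiro_corrected` at `D`'s section datum `sectionRamificationOf D`. Route: the place `v̲ ∩ 𝓞_F` lies in
`V(F)^bad` (`mk_mem_VFbad_of_under`, `under_liftPlace`), so `e(v̲|p) ≥ l ≥ 5`
(`absRamificationIdx_ne_one_of_under_mem_VFbad`), and `ramIdx K v̲ = e(v̲|p)`
(`Ideal.ramificationIdx'_eq_ramificationIdx`). [cite: DupuyHilado2020, Lemma 6.3.1 proof p.22 l.24]
[cite: Mochizuki2012, IUTchI Def. 3.1 (c) p. 62; Ex. 3.2 (iv) p. 71] -/
theorem sectionRamificationOf_e_ne_one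
    (v : HeightOneSpectrum (𝓞 (fieldOfModuli E))) (hv : v ∈ (ThetaData.pilotData D).S) :
    (sectionRamificationOf D).e v ≠ 1 := by
  rw [ThetaData.pilotData_S] at hv
  set w := ThetaData.liftPlace D v with hw
  have hunder : (w.under (𝓞 F)).under (𝓞 (fieldOfModuli E)) = v := by
    apply HeightOneSpectrum.ext
    rw [HeightOneSpectrum.under_asIdeal, HeightOneSpectrum.under_asIdeal, Ideal.under_under,
      ← HeightOneSpectrum.under_asIdeal, hw, ThetaData.under_liftPlace D v]
  have hbad : FinitePlace.mk (w.under (𝓞 F)) ∈ D.VFbad := ThetaData.mk_mem_VFbad_of_under D hv hunder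
  have habs := ThetaData.absRamificationIdx_ne_one_of_under_mem_VFbad D hbad
  have hne : Ideal.span {(residueChar K w : ℤ)} ≠ ⊥ := by simp [(residueChar_prime K w).ne_zero]
  have h2 : ramIdx K w = w.asIdeal.ramificationIdx ℤ := by
    unfold ramIdx
    exact Ideal.ramificationIdx'_eq_ramificationIdx (p := Ideal.span {(residueChar K w : ℤ)})
      (q := w.asIdeal) hne
  show ramIdx K w ≠ 1
  rw [h2]
  exact habs

omit [DecidableEq F] [DecidableEq Fbar] in
/-- **Theorem 1.0.3 = 7.12.1 at `D`, corrected constants, from (7.4) alone**: `probabilisticSzpiro_corrected`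
at `D`'s pilot and section data with its hypothesis `bad ⇒ ramified` discharged by
`sectionRamificationOf_e_ne_one`. The bracket `ln π + (4/(l+5))·Σ_p (1 − P_{unr,p}^{(l+1)/2})·ln p` replaces
print's `A_{l,V}` (E-21/E-22); `Ineq74` is the only hypothesis left. [cite: DupuyHilado2020, Thm 1.0.3 p.3 l.20–35; Thm 7.12.1 (7.15) p.27 l.33 – p.28 l.64] -/
theorem probabilisticSzpiro_corrected_thetaData (T : Finset ℕ)
    (hT : ∀ p ∈ T, p.Prime) (hS : ∀ v ∈ (ThetaData.pilotData D).S, residueChar (fieldOfModuli E) v ∈ T)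
    (h74 : Ineq74 (ThetaData.pilotData D) (sectionRamificationOf D) T) :
    (1 / (6 + epsProb (ThetaData.pilotData D).l)) *
        FinDivisor.ndeg (fieldOfModuli E) (ThetaData.pilotData D).qDivisor ≤
      (sectionRamificationOf D).lnAvgDifferent T +
        (∑ p ∈ T, Real.log ((sectionRamificationOf D).avgRamIdx p)) +
        (Real.log Real.pi + (4 / (((ThetaData.pilotData D).l : ℝ) + 5)) *
          ∑ p ∈ T, (1 - (sectionRamificationOf D).probUnram p ^ ((ThetaData.pilotData D).lstar + 1)) *
            Real.log p) :=
  probabilisticSzpiro_corrected (ThetaData.pilotData D) (sectionRamificationOf D) T hT hS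
    (sectionRamificationOf_e_ne_one D) h74

/-- **Theorem 1.0.4 = 7.13.1 (Baby Szpiro) at `D`** — the typed template `BabySzpiroThm D T` with conclusion
(7.17) AS PRINTED — from (7.18) at `D` over `T` and print's floor `[K:ℚ], |Disc(K/ℚ)| ≥ 6840` (p.29 l.27) ONLY
(`babySzpiroThm_of_inputs` with `bad ⇒ ramified` discharged). [cite: DupuyHilado2020, Thm 1.0.4 p.3 l.44–56; Thm 7.13.1 p.28 l.65 – p.29 l.33] -/
theorem babySzpiroThm_of_ineq718 (T : Finset ℕ)
    (hd : 6840 ≤ Module.finrank ℚ K) (hD : 6840 ≤ (NumberField.discr K).natAbs)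
    (h18 : (sectionRamificationOf D).lnAvgDifferent T ≤
      Real.log ((∏ p ∈ (NumberField.discr K).natAbs.primeFactors, (p : ℝ)) * Module.finrank ℚ K)) :
    BabySzpiroThm D T :=
  babySzpiroThm_of_inputs D T (sectionRamificationOf_e_ne_one D) hd hD h18

end ExplicitSzpiro

end Literature.IUT.LogVolume

end
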